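/-
Copyright (c) 2026 the pub-hodgecm-mathlib formalisation cell (harness21).  Prover seats hodgecm-mathlib-F0P2-p06 (g10) (statement texts) and hodgecm-mathlib-F0P3a-p07 (g11) (proofs, by paste; A-89 (b)),
2026-09-01.  Road «S3-tree», brick T3′ «depth-zero κ-transfer», population (P-2) TYPE (2), row (R0²): organ FILE β «RESIDUALLY SKEW SHIFT UNITS» — the two residual units
`det(2 + t·X₂)` (`t ≡ ±1`) and `2 + t·y` of the type-(2) Möbius∕Cayley shift, from unitarity ALONE (no eigenvalue, no residue field of the splitting field `K₁`).
-/
import Mathlib.LinearAlgebra.Matrix.Charpoly.Coeff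
import Mathlib.LinearAlgebra.Matrix.NonsingularInverse
import Mathlib.Topology.Algebra.Valued.ValuationTopology
import HarnessLib

/-!
# Residually skew shift units: `|4 + 2st + pt²| = 1` and `|2 + yt| = 1` for residually skew `s, y`, `t ≡ ±1`, and the skewness of `tr X`, `y` from unitarity

Topic `NumberTheory/Automorphic`; namespace `Literature.NumberTheory.Automorphic.MoebiusShift`.  THEOREMS ONLY (no definition, no instance, no notation, no named fact, no
`sorry`); statement texts F0P2-p06 (g10) (statement-first 24e5aa36c1d324d7), proofs F0P3a-p07 (g11) (A-89 (b)); generic `[Field K] [Valued K ℤᵐ⁰]` with an isometric ring endomorphism `σ`.  Cell `pub/hodgecm-mathlib`,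
crux H413 = `stmt-HodgeConjecture-24833`; road «S3-tree», brick T3′, row (R0²) of the ★ type-(2) socket p846003 (census `F0/P2/F0P2-p06/g10/CENSUS-T3prime-P2-assembly.F0P2p06g10.md` §3 (b)).
HONEST LABEL: HC_CM is proved only modulo the cell's 2 remaining named inputs (hLiu418, h413) until rung 0 closes; scalar valuation arithmetic, asserts nothing printed.

THE MATHEMATICS (census §3 (b)).  For a deep type-(2) `γ_H = (g, u)` at a non-split unramified place (`E = L_w`, uniformiser `ϖ = c` with `σ c = c`, `|2| = 1`) write `g = 1 + cX₂`,
`u = 1 + cy` with `X₂`, `y` integral.  Unitarity `ᵗ(σg)Jg = J` (`J` unimodular integral) gives `ᵗ(σX₂)J + JX₂ = −c·ᵗ(σX₂)JX₂`, hence (trace after `J⁻¹·`) `σ(tr X₂) + tr X₂ ∈ c𝒪`: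
the trace `s = tr X₂` is RESIDUALLY SKEW (§1); likewise `σy + y ∈ c𝒪`.  The discriminant `s² − 4p` (`p = det X₂`) equals `c⁻²·disc χ_g` (§3), of positive order when
`ord disc χ_g = 2N+1 ≥ 3`, so residually `χ̄_{X₂} = (T − s̄∕2)²` — a square IN `k_E[T]` (no residue field of the ramified splitting field needed).  A residually skew element is never
`≡ ±2, ±4`: `s ≡ −4ε ⇒ σs ≡ −4ε ⇒ σs + s ≡ −8ε`, contradicting `|8| = 1` (§2 — any ring map fixes the integers; no Frobenius).  Hence the Möbius denominators are units:
`det(2 + tX₂) = 4 + 2st + pt²` with `4·(4 + 2εs + p) ≡ (4 + εs)²` (§2∕§3) and `2 + ty ≡ 2 + εy` (`t ≡ ε = ±1`).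

* §1 `valued_map_trace_add_trace_lt_one_of_unitary` (any size), `valued_map_add_lt_one_of_unitary_one` (size 1).
* §2 `valued_four_add_eq_one`, `valued_two_add_mul_eq_one`.
* §3 `trace_sq_sub_four_det_one_add_smul` (`disc χ_{1+cX} = c²·disc χ_X`, `2 × 2`), `valued_det_two_smul_one_add_smul_eq_one` (`|det(2 + tX₂)| = 1`, `2 × 2`).

## References
* [Rogawski1990] J. D. Rogawski, *Automorphic Representations of Unitary Groups in Three Variables* (1990), §4.9 Prop. 4.9.1 (b) p. 55; §3.5–3.6 (tori at non-split places).
* [Kottwitz1986] R. E. Kottwitz, *Base change for unit elements of Hecke algebras*, Compositio Math. 60 (1986), §3.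
* [SerreLocalFields1979] J.-P. Serre, *Local Fields* (1979), Ch. I §§1–2 (valuation rings, units).
-/

set_option autoImplicit false

open Matrix
open scoped Valued WithZero

namespace Literature.NumberTheory.Automorphic.MoebiusShift

variable {K : Type*} [Field K] [Valued K ℤᵐ⁰]

/-! ## §0 Helpers: integrality of determinants, adjugates, traces; the residual-skew unit trick -/

/-- The cast of a permutation sign has valuation `1`. [cite: SerreLocalFields1979, Ch. I §§1–2] -/
theorem valued_intCast_units_eq_one (u : ℤˣ) : Valued.v (((u : ℤ) : K)) = 1 := by
  rcases Int.units_eq_one_or u with h | h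
  · rw [h, Units.val_one, Int.cast_one, map_one]
  · rw [h, Units.val_neg, Units.val_one, Int.cast_neg, Int.cast_one, Valuation.map_neg, map_one]

/-- **The determinant of an integral matrix is integral.** [cite: SerreLocalFields1979, Ch. I §§1–2] -/
theorem valued_det_le_one {m : Type*} [Fintype m] [DecidableEq m] {A : Matrix m m K} (hA : ∀ i j, Valued.v (A i j) ≤ 1) : Valued.v A.det ≤ 1 := by
  rw [Matrix.det_apply']
  refine Valuation.map_sum_le _ fun σ _ => ?_
  rw [map_mul, valued_intCast_units_eq_one, one_mul, map_prod]
  exact Finset.prod_le_one' fun i _ => hA _ _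

/-- **The adjugate of an integral matrix is integral.** [cite: SerreLocalFields1979, Ch. I §§1–2] -/
theorem valued_adjugate_le_one {m : Type*} [Fintype m] [DecidableEq m] {A : Matrix m m K} (hA : ∀ i j, Valued.v (A i j) ≤ 1) (i j : m) :
    Valued.v (A.adjugate i j) ≤ 1 := by
  rw [Matrix.adjugate_apply]
  refine valued_det_le_one fun k l => ?_
  rw [Matrix.updateRow_apply]
  split_ifs
  · by_cases hl : l = i
    · subst hl; rw [Pi.single_eq_same, map_one]
    · rw [Pi.single_eq_of_ne hl, map_zero]; exact zero_le
  · exact hA k l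

/-- The trace of an integral matrix is integral. [cite: SerreLocalFields1979, Ch. I §§1–2] -/
theorem valued_trace_le_one {m : Type*} [Fintype m] {A : Matrix m m K} (hA : ∀ i j, Valued.v (A i j) ≤ 1) : Valued.v A.trace ≤ 1 :=
  Valuation.map_sum_le _ fun i _ => hA i i

/-- Entries of a product of integral matrices are integral. [cite: SerreLocalFields1979, Ch. I §§1–2] -/
theorem valued_mul_apply_le_one {m : Type*} [Fintype m] {A B : Matrix m m K} (hA : ∀ i j, Valued.v (A i j) ≤ 1) (hB : ∀ i j, Valued.v (B i j) ≤ 1) (i j : m) :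
    Valued.v ((A * B) i j) ≤ 1 := by
  rw [Matrix.mul_apply]
  exact Valuation.map_sum_le _ fun k _ => by rw [map_mul]; exact mul_le_one' (hA i k) (hB k j)

omit [Valued K ℤᵐ⁰] in
/-- `tr (X.map σ) = σ (tr X)`. [cite: Kottwitz1986, §3] -/
theorem trace_map_ringHom {m : Type*} [Fintype m] (σ : K →+* K) (X : Matrix m m K) : (X.map σ).trace = σ X.trace := by
  simp only [Matrix.trace, Matrix.diag, Matrix.map_apply, map_sum]

/-- **THE RESIDUAL-SKEW UNIT TRICK**: if `σ` is isometric and fixes `n` with `|n + n| = 1`, `s` is integral and residually skew (`|σs + s| < 1`), and `t ≡ ε = ±1`, then `|n + s·t| = 1`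
(else `s ≡ −εn ≡ σs`, so `σs + s ≡ −2εn`, `|2n| < 1`). [cite: SerreLocalFields1979, Ch. I §§1–2] -/
theorem valued_add_mul_eq_one_of_skew (σ : K →+* K) (hσ : ∀ x, Valued.v (σ x) = Valued.v x) {n : K} (hσn : σ n = n) (hn : Valued.v n ≤ 1) (hnn : Valued.v (n + n) = 1)
    {s t : K} (hs : Valued.v s ≤ 1) (ht : Valued.v t ≤ 1) (hskew : Valued.v (σ s + s) < 1) (ht1 : Valued.v (t - 1) < 1 ∨ Valued.v (t + 1) < 1) :
    Valued.v (n + s * t) = 1 := by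
  -- `t ≡ ε`, `ε = ±1`
  obtain ⟨ε, hε, hσε, htε⟩ : ∃ ε : K, (ε = 1 ∨ ε = -1) ∧ σ ε = ε ∧ Valued.v (t - ε) < 1 := by
    rcases ht1 with h | h
    · exact ⟨1, Or.inl rfl, map_one σ, h⟩
    · exact ⟨-1, Or.inr rfl, by rw [map_neg, map_one], by rw [sub_neg_eq_add]; exact h⟩
  have hle : Valued.v (n + s * t) ≤ 1 := Valuation.map_add_le _ hn (by rw [map_mul]; exact mul_le_one' hs ht)
  by_contra hne
  have hlt : Valued.v (n + s * t) < 1 := lt_of_le_of_ne hle hne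
  -- `|n + sε| < 1`
  have hε1 : Valued.v (n + s * ε) < 1 := by
    have h : n + s * ε = (n + s * t) - s * (t - ε) := by ring
    rw [h]
    refine Valuation.map_sub_lt _ hlt ?_
    rw [map_mul]; exact lt_of_le_of_lt (mul_le_of_le_one_left' hs) htε
  -- `|n + σs·ε| < 1`
  have hε2 : Valued.v (n + σ s * ε) < 1 := by
    have h : σ (n + s * ε) = n + σ s * ε := by rw [map_add, map_mul, hσn, hσε]
    rw [← h, hσ]; exact hε1
  -- `(n + sε) + (n + σs·ε) − ε(σs + s) = n + n`
  have hsum : (n + s * ε) + (n + σ s * ε) - ε * (σ s + s) = n + n := by ring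
  have hlt2 : Valued.v (n + n) < 1 := by
    rw [← hsum]
    refine Valuation.map_sub_lt _ (Valuation.map_add_lt _ hε1 hε2) ?_
    rw [map_mul]
    have hvε : Valued.v ε ≤ 1 := by rcases hε with rfl | rfl <;> simp
    exact lt_of_le_of_lt (mul_le_of_le_one_left' hvε) hskew
  rw [hnn] at hlt2
  exact lt_irrefl _ hlt2

/-! ## §1 Residual skewness from unitarity -/

/-- **The trace of `X = c⁻¹(g − 1)` is residually skew when `g` is unitary**: for `g = 1 + c·X ∈ U(σ, J)` with `X` integral, `J` integral unimodular, `σ` isometric fixing `c`,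
`0 < |c| < 1`: `|σ(tr X) + tr X| < 1`. [cite: Rogawski1990, §3.5–3.6] [cite: Kottwitz1986, §3] -/
theorem valued_map_trace_add_trace_lt_one_of_unitary {m : Type*} [Fintype m] [DecidableEq m] (σ : K →+* K) (hσ : ∀ x, Valued.v (σ x) = Valued.v x)
    {J : Matrix m m K} (hJ : ∀ i j, Valued.v (J i j) ≤ 1) (hJd : Valued.v J.det = 1)
    {c : K} (hc0 : c ≠ 0) (hc : Valued.v c < 1) (hσc : σ c = c)
    {X : Matrix m m K} (hX : ∀ i j, Valued.v (X i j) ≤ 1)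
    (hg : (((1 : Matrix m m K) + c • X).map σ)ᵀ * J * ((1 : Matrix m m K) + c • X) = J) :
    Valued.v (σ X.trace + X.trace) < 1 := by
  set A : Matrix m m K := (X.map σ)ᵀ with hA
  have hAint : ∀ i j, Valued.v (A i j) ≤ 1 := fun i j => by rw [hA, Matrix.transpose_apply, Matrix.map_apply, hσ]; exact hX j i
  -- expand the unitarity relation: `AJ + JX = −c·AJX`
  have hmapσ : ((1 : Matrix m m K) + c • X).map σ = 1 + c • X.map σ := by
    ext i j
    simp only [Matrix.map_apply, Matrix.add_apply, Matrix.smul_apply, smul_eq_mul, map_add, map_mul, hσc, Matrix.one_apply]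
    split_ifs <;> simp
  have hmapσT : (((1 : Matrix m m K) + c • X).map σ)ᵀ = 1 + c • A := by
    rw [hmapσ, Matrix.transpose_add, Matrix.transpose_one, Matrix.transpose_smul]
  have hprod : ((1 : Matrix m m K) + c • A) * J * (1 + c • X) = J + c • (A * J + J * X + c • (A * J * X)) := by
    simp only [add_mul, mul_add, one_mul, mul_one, smul_mul_assoc, mul_smul_comm, smul_add, smul_smul, Matrix.mul_assoc]
    abel
  have hexp : J + c • (A * J + J * X + c • (A * J * X)) = J := by
    rw [← hprod, ← hmapσT]; exact hg
  have hrel : A * J + J * X = -(c • (A * J * X)) := by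
    have h : c • (A * J + J * X + c • (A * J * X)) = 0 := by
      have h' := hexp; rw [add_eq_left] at h'; exact h'
    have h2 := (smul_eq_zero.1 h).resolve_left hc0
    rw [← sub_eq_zero, sub_neg_eq_add]; exact h2
  -- multiply by `adj J` on the left and take traces: `det J · (σ tr X + tr X) = −c · tr (adj J · A · J · X)`
  have hadj : J.adjugate * J = J.det • (1 : Matrix m m K) := Matrix.adjugate_mul J
  have htr : J.det * (σ X.trace + X.trace) = -(c * (J.adjugate * (A * J * X)).trace) := by
    have h := congrArg (fun M => (J.adjugate * M).trace) hrel
    simp only [mul_add, Matrix.mul_neg, Matrix.mul_smul, Matrix.trace_add, Matrix.trace_neg, Matrix.trace_smul, smul_eq_mul] at h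
    have h1 : (J.adjugate * (A * J)).trace = J.det * σ X.trace := by
      rw [Matrix.trace_mul_comm, Matrix.mul_assoc, Matrix.mul_adjugate, Matrix.mul_smul, Matrix.mul_one, Matrix.trace_smul, smul_eq_mul, hA,
        Matrix.trace_transpose, trace_map_ringHom]
    have h2 : (J.adjugate * (J * X)).trace = J.det * X.trace := by
      rw [← Matrix.mul_assoc, hadj, Matrix.smul_mul, Matrix.one_mul, Matrix.trace_smul, smul_eq_mul]
    rw [h1, h2] at h
    linear_combination h
  -- valuations
  have hint : Valued.v (J.adjugate * (A * J * X)).trace ≤ 1 :=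
    valued_trace_le_one (valued_mul_apply_le_one (valued_adjugate_le_one hJ) (valued_mul_apply_le_one (valued_mul_apply_le_one hAint hJ) hX))
  have h := congrArg Valued.v htr
  rw [map_mul, hJd, one_mul, Valuation.map_neg, map_mul] at h
  rw [h]
  exact lt_of_le_of_lt (mul_le_of_le_one_right' hint) hc

/-- **Size one**: for `u = 1 + c·y` with `σ(u)·u = 1`, `y` integral: `|σy + y| < 1`. [cite: Rogawski1990, §3.5–3.6] -/
theorem valued_map_add_lt_one_of_unitary_one (σ : K →+* K) (hσ : ∀ x, Valued.v (σ x) = Valued.v x) {c : K} (hc0 : c ≠ 0) (hc : Valued.v c < 1) (hσc : σ c = c)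
    {y : K} (hy : Valued.v y ≤ 1) (hu : σ (1 + c * y) * (1 + c * y) = 1) : Valued.v (σ y + y) < 1 := by
  rw [map_add, map_one, map_mul, hσc] at hu
  have h : c * ((σ y + y) + c * (σ y * y)) = 0 := by linear_combination hu
  have h2 : σ y + y = -(c * (σ y * y)) := by
    have h' := (mul_eq_zero.1 h).resolve_left hc0
    linear_combination h'
  rw [h2, Valuation.map_neg, map_mul, map_mul, hσ]
  exact lt_of_le_of_lt (mul_le_of_le_one_right' (mul_le_one' hy hy)) hc

/-! ## §2 A residually skew element is not `±2`, `±4`: the two scalar units -/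

/-- **`|4 + 2st + pt²| = 1`** for integral `s, p, t` with `|s² − 4p| < 1` (residually a square), `s` residually skew, `t ≡ ±1`, `|2| = 1`. [cite: SerreLocalFields1979, Ch. I §§1–2] -/
theorem valued_four_add_eq_one (σ : K →+* K) (hσ : ∀ x, Valued.v (σ x) = Valued.v x) (h2 : Valued.v (2 : K) = 1)
    {s p t : K} (hs : Valued.v s ≤ 1) (_hp : Valued.v p ≤ 1) (ht : Valued.v t ≤ 1)
    (hdisc : Valued.v (s ^ 2 - 4 * p) < 1) (hskew : Valued.v (σ s + s) < 1) (ht1 : Valued.v (t - 1) < 1 ∨ Valued.v (t + 1) < 1) :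
    Valued.v (4 + 2 * s * t + p * t ^ 2) = 1 := by
  have h4 : Valued.v (4 : K) = 1 := by rw [show (4 : K) = 2 * 2 by norm_num, map_mul, h2, one_mul]
  have h8 : Valued.v ((4 : K) + 4) = 1 := by rw [show (4 : K) + 4 = 2 * (2 * 2) by norm_num, map_mul, map_mul, h2, one_mul, one_mul]
  -- `|4 + st| = 1`
  have hunit : Valued.v (4 + s * t) = 1 := valued_add_mul_eq_one_of_skew σ hσ (map_ofNat σ 4) h4.le h8 hs ht hskew ht1
  -- `4·(4 + 2st + pt²) = (4 + st)² − t²(s² − 4p)`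
  have hid : 4 * (4 + 2 * s * t + p * t ^ 2) = (4 + s * t) ^ 2 - t ^ 2 * (s ^ 2 - 4 * p) := by ring
  have hlt : Valued.v (t ^ 2 * (s ^ 2 - 4 * p)) < Valued.v ((4 + s * t) ^ 2) := by
    rw [map_pow, hunit, one_pow, map_mul, map_pow]
    exact lt_of_le_of_lt (mul_le_of_le_one_left' (pow_le_one' ht 2)) hdisc
  have h := Valuation.map_sub_eq_of_lt_left _ hlt
  rw [← hid, map_mul, h4, one_mul, map_pow, hunit, one_pow] at h
  exact h

/-- **`|2 + yt| = 1`** for integral `y, t` with `y` residually skew, `t ≡ ±1`, `|2| = 1`. [cite: SerreLocalFields1979, Ch. I §§1–2] -/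
theorem valued_two_add_mul_eq_one (σ : K →+* K) (hσ : ∀ x, Valued.v (σ x) = Valued.v x) (h2 : Valued.v (2 : K) = 1)
    {y t : K} (hy : Valued.v y ≤ 1) (ht : Valued.v t ≤ 1) (hskew : Valued.v (σ y + y) < 1) (ht1 : Valued.v (t - 1) < 1 ∨ Valued.v (t + 1) < 1) :
    Valued.v (2 + y * t) = 1 := by
  have h4 : Valued.v ((2 : K) + 2) = 1 := by rw [show (2 : K) + 2 = 2 * 2 by norm_num, map_mul, h2, one_mul]
  exact valued_add_mul_eq_one_of_skew σ hσ (map_ofNat σ 2) h2.le h4 hy ht hskew ht1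

/-! ## §3 The `2 × 2` glue: discriminant under `g = 1 + cX`, and the determinant unit -/

omit [Valued K ℤᵐ⁰] in
/-- `disc χ_{1 + cX} = c²·disc χ_X` for a `2 × 2` matrix `X`. [cite: Kottwitz1986, §3] -/
theorem trace_sq_sub_four_det_one_add_smul (X : Matrix (Fin 2) (Fin 2) K) (c : K) :
    ((1 : Matrix (Fin 2) (Fin 2) K) + c • X).trace ^ 2 - 4 * ((1 : Matrix (Fin 2) (Fin 2) K) + c • X).det = c ^ 2 * (X.trace ^ 2 - 4 * X.det) := by
  simp only [Matrix.trace_fin_two, Matrix.det_fin_two, Matrix.add_apply, Matrix.smul_apply, Matrix.one_apply_eq, Matrix.one_apply_ne (by decide : (0 : Fin 2) ≠ 1),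
    Matrix.one_apply_ne (by decide : (1 : Fin 2) ≠ 0), smul_eq_mul]
  ring

/-- **`|det(2 + t·X)| = 1`** for a `2 × 2` integral `X` with residually-square characteristic polynomial (`|tr² − 4det| < 1`), residually skew trace, `t ≡ ±1`, `|2| = 1`.
[cite: Kottwitz1986, §3] [cite: SerreLocalFields1979, Ch. I §§1–2] -/
theorem valued_det_two_smul_one_add_smul_eq_one (σ : K →+* K) (hσ : ∀ x, Valued.v (σ x) = Valued.v x) (h2 : Valued.v (2 : K) = 1)
    {X : Matrix (Fin 2) (Fin 2) K} (hX : ∀ i j, Valued.v (X i j) ≤ 1) (hdisc : Valued.v (X.trace ^ 2 - 4 * X.det) < 1) (hskew : Valued.v (σ X.trace + X.trace) < 1)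
    {t : K} (ht : Valued.v t ≤ 1) (ht1 : Valued.v (t - 1) < 1 ∨ Valued.v (t + 1) < 1) :
    Valued.v (((2 : K) • (1 : Matrix (Fin 2) (Fin 2) K) + t • X).det) = 1 := by
  have hdet : ((2 : K) • (1 : Matrix (Fin 2) (Fin 2) K) + t • X).det = 4 + 2 * X.trace * t + X.det * t ^ 2 := by
    simp only [Matrix.trace_fin_two, Matrix.det_fin_two, Matrix.add_apply, Matrix.smul_apply, Matrix.one_apply_eq, Matrix.one_apply_ne (by decide : (0 : Fin 2) ≠ 1),
      Matrix.one_apply_ne (by decide : (1 : Fin 2) ≠ 0), smul_eq_mul]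
    ring
  rw [hdet]
  have htr : Valued.v X.trace ≤ 1 := valued_trace_le_one hX
  have hd : Valued.v X.det ≤ 1 := valued_det_le_one hX
  exact valued_four_add_eq_one σ hσ h2 htr hd ht hdisc hskew ht1

end Literature.NumberTheory.Automorphic.MoebiusShift
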